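import Summits.HodgeConjecture.FermatCycles.ShiodaConditionFourfold
import HarnessLib

/-!
# Shioda's condition `(P⁴₅₇)` by kernel exhaustion — part A (first representatives `a ≤ 6`)

HONEST FRAMING: explicit algebraic cycles for specific Hodge classes on Fermat/Delsarte varieties;
residual open instances listed; no claim on general Hodge.

Companion of `ShiodaConditionFourfold.lean` (sound search `checkB6`, `(P⁴₃₉)`) and `ShiodaConditionFourfoldFiftyOne.lean`, cell
`pub-hfermat`, topic path `Summits/HodgeConjecture/FermatCycles/` (new work, not literature). THEOREMS ONLY. `57 = 3·19` is the third
degree (after `39`, `51`) at which the cell's enumeration finds `(P⁴ₘ)` TRUE in the PJA / da Silva form with no refereed theorem for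
`X⁴ₘ`. The search at `N = 57` visits 522 780 sorted tuples (4 582 Hodge `6`-multisets: 4 564 with a pair, 18 quasi-decomposable;
prototype `code/lit/p39/proto.py 57`); it is split over two files to keep each under the farm's time budget: this part runs the six
chunks `a = 1, …, 6` (249 450 tuples), `ShiodaConditionFourfoldFiftySeven.lean` runs `a ≥ 7` and assembles
`shiodaConditionUpTo_fiftySeven_four`.

PRINT STATUS (lit seat, 2026-08-20): no REFEREED theorem covers this degree; PUBLIC PRIORITY for HC(X⁴ₘ) at every odd `m ≤ 199` belongs to the
computer-assisted preprint [Jumagulov2026OddFermatFourfolds] (arXiv:2608.18134, July 2026; Thm 1.1, census Thm 1.5), whose Appendix C row at this level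
(`m = 57`: 265 Galois orbits = 264 decomposable + 1 quasi-decomposable) the cell reproduces by two independent enumerations (`code/lit/census/orbits.py`); this file is an INDEPENDENT
certificate checked by the Lean kernel, not a first claim.

References: [Shioda1979PJA] T. Shioda, Proc. Japan Acad. 55A (1979) §1 (Pⁿₘ), §2 Thm 1; [daSilva2021HodgeFermat] Def. 2.4, Prop. 3.1.
[Jumagulov2026OddFermatFourfolds] R. Jumagulov, arXiv:2608.18134 (preprint, July 2026), Thm 1.1, Thm 1.5, Appendix C.
-/

namespace Summit.HodgeConjecture.FermatCycles.ShiodaConditionFourfold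

set_option maxHeartbeats 0 in
/-- The search at `N = 57`, first representative `a = 1` (44390 tuples). Kernel. [cite: Shioda1979PJA, §1 condition (Pⁿₘ), n = 4] -/
theorem checkB6_57_1 : checkB6 57 1 1 = true := by decide +kernel

set_option maxHeartbeats 0 in
/-- The search at `N = 57`, first representative `a = 2` (43597 tuples). Kernel. [cite: Shioda1979PJA, §1 condition (Pⁿₘ), n = 4] -/
theorem checkB6_57_2 : checkB6 57 2 1 = true := by decide +kernel

set_option maxHeartbeats 0 in
/-- The search at `N = 57`, first representative `a = 3` (42562 tuples). Kernel. [cite: Shioda1979PJA, §1 condition (Pⁿₘ), n = 4] -/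
theorem checkB6_57_3 : checkB6 57 3 1 = true := by decide +kernel

set_option maxHeartbeats 0 in
/-- The search at `N = 57`, first representative `a = 4` (41265 tuples). Kernel. [cite: Shioda1979PJA, §1 condition (Pⁿₘ), n = 4] -/
theorem checkB6_57_4 : checkB6 57 4 1 = true := by decide +kernel

set_option maxHeartbeats 0 in
/-- The search at `N = 57`, first representative `a = 5` (39719 tuples). Kernel. [cite: Shioda1979PJA, §1 condition (Pⁿₘ), n = 4] -/
theorem checkB6_57_5 : checkB6 57 5 1 = true := by decide +kernel

set_option maxHeartbeats 0 in
/-- The search at `N = 57`, first representative `a = 6` (37917 tuples). Kernel. [cite: Shioda1979PJA, §1 condition (Pⁿₘ), n = 4] -/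
theorem checkB6_57_6 : checkB6 57 6 1 = true := by decide +kernel

end Summit.HodgeConjecture.FermatCycles.ShiodaConditionFourfold
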